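import Summits.Ventures.Crystal3D.Theorems.StickyWulffConstantGenericWallFloorEndBallUniverse
import Summits.Ventures.Crystal3D.Theorems.StickyWulffConstantGenericWallFloorEndBallMenuDefs
import Summits.Ventures.Crystal3D.Theorems.StickyWulffConstantGenericWallFloorShellRowCertBridgeA
import Summits.Ventures.Crystal3D.Theorems.StickyWulffConstantCoaxialWallLawForeignTilt
import HarnessLib

/-!
# The end-ball universe lemma as an INTEGER TABLE: «payer, or `x = z + A·pointVec q` with `q ∈ menuQ3`»
# (crux `GenericWallFloor`, stmt-Ventures-19480, line `WallLedgerG`; cf-p1 ORDER 2026-08-28T20:38Z (1), finite-table interface for cf-p2 §51)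

HONEST FRAMING. Venture `Summits/Ventures/Crystal3D` (cell `crystal3d-full`), helper `--supports` the crux `GenericWallFloor`
of `route-Ventures-StickyWulffConstant`, REGISTERED line `WallLedgerG`, open stub `stub_twoSlabAdhesion`.  Rung credit only;
F-C1 not moved; NOT the crux.  Census-free, standard axioms (two 96-case `decide`s on the slot/cube tables); GAP/CLASSIFICATION
at `δ ≥ 5/2` are hypotheses as in `…EndBallUniverse`.

THE BRIDGE from the abstract dozens of `menu_or_payer_of_near_endBall` (…EndBallUniverse) to the integer table `dozenQ3` /
`menuQ3` (…EndBallMenuDefs; `q ↦ pointVec q`, cubic coordinates `q/(3√2)`):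
* §1 `pointVec` is additive; `slotSite_eq_pointVec : slotSite i = pointVec (3 • slotInt i)`; `sdot3_slotInt_cubeInt` (slot ⬝ cube
  vertex `∈ {0, ±2}`, `decide`).
* §2 `exists_cubeInt_of_menu_normal` — a unit menu normal `n` of the frame `A` is `A (pointVec-direction)` of a cube vertex:
  `cubicCoords (A⁻¹ n) = cubeInt c / √3` (from `menu_cubic_coords_pm_one`, …CoaxialWallLawForeignTilt); `inner_slot_menu_normal`:
  `⟪A (slotSite i), n⟫ = (slotInt i ⬝ cubeInt c)/√6`; `twinRefl_slot_eq_pointVec`: the twin image `A w − 2⟪A w, n⟫ n` of a slot with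
  `slotInt i ⬝ cubeInt c = −2` is `A (pointVec (3 • slotInt i + 4 • cubeInt c))`.
* §3 `slotDozen_eq_image_dozenQ3`, `twinDozen_eq_image_dozenQ3` — the abstract dozens ARE the images `A ∘ pointVec` of the
  table dozens `dozenQ3 none` / `dozenQ3 (some c)`.
* §4 **`menuTable_or_payer_of_near_endBall`** — GAP/CLASS (`δ ≥ 5/2`), `X` `1`-separated, `z ∈ X` with certified slot contacts
  `z + A (slotSite i)` (`i ∈ S`) and `deg z ≤ |S| + 1`: every `x ∈ X`, `x ≠ z`, `dist x z ≤ √3` has a payer `y ≠ z` within `2`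
  (`deg y ≤ 11`) OR, for one table dozen `dozenQ3 o` and one `q′ ∈ dozenQ3 o`, the docking ball `z − A·pointVec q′ ∈ X` is
  twelve-touched with contacts EXACTLY `{z − A·pointVec q′ + A·pointVec q : q ∈ dozenQ3 o} ⊆ X`, `dist x (docking ball) ≤ 1`, and
  `x` is the docking ball or one of those twelve; **`mem_menuQ3_or_payer_of_near_endBall`**: payer, or `x = z + A·pointVec q`
  with `q ∈ menuQ3` — the finite universe (207 integer triples; 147 within `√3`) over which cf-p2's §51 classes range.
WHAT THIS IS NOT: no class enumeration, no ledger; the count hypothesis `deg z ≤ |S| + 1` is inherited; F-C1 not moved.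
-/

noncomputable section

namespace Summit.Ventures.Crystal3D.Theorems

open Summit.Ventures.Crystal3D Finset NearIdentity
open scoped InnerProductSpace

variable {X : Finset (EuclideanSpace ℝ (Fin 3))}

/-! ### §1 `pointVec` bookkeeping -/

/-- Cubic coordinates of `pointVec q`. -/
theorem cubicCoords_pointVec (q : Fin 3 → ℤ) : cubicCoords (pointVec q) = fun k => (q k : ℝ) / (3 * Real.sqrt 2) :=
  cubicCoords_ofCubic _

/-- `pointVec` is additive. -/
theorem pointVec_add (a b : Fin 3 → ℤ) : pointVec (a + b) = pointVec a + pointVec b := by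
  apply cubicCoords_injective
  rw [cubicCoords_add, cubicCoords_pointVec, cubicCoords_pointVec, cubicCoords_pointVec]
  ext k; simp only [Pi.add_apply, Int.cast_add]; ring

/-- `pointVec` respects subtraction. -/
theorem pointVec_sub (a b : Fin 3 → ℤ) : pointVec (a - b) = pointVec a - pointVec b := by
  apply cubicCoords_injective
  rw [cubicCoords_sub, cubicCoords_pointVec, cubicCoords_pointVec, cubicCoords_pointVec]
  ext k; simp only [Pi.sub_apply, Int.cast_sub]; ring

/-- `pointVec` respects negation. -/
theorem pointVec_neg (a : Fin 3 → ℤ) : pointVec (-a) = -pointVec a := by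
  have h := pointVec_sub 0 a
  have h0 : pointVec 0 = 0 := by
    apply cubicCoords_injective
    rw [cubicCoords_pointVec]
    have : cubicCoords (0 : EuclideanSpace ℝ (Fin 3)) = 0 := by
      have e := cubicCoords_sub (pointVec a) (pointVec a)
      rwa [sub_self, sub_self] at e
    rw [this]; ext k; simp
  rwa [zero_sub, h0, zero_sub] at h

/-- **The slots in the table:** `slotSite i = pointVec (3 • slotInt i)`. -/
theorem slotSite_eq_pointVec (i : Fin 12) : slotSite i = pointVec (3 • slotInt i) := by
  apply cubicCoords_injective
  rw [cubicCoords_slotSite, cubicCoords_pointVec]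
  ext k
  simp only [slotVec, Pi.smul_apply, nsmul_eq_mul]
  push_cast
  have hs : Real.sqrt 2 ≠ 0 := by positivity
  field_simp

/-- Slot ⬝ cube vertex is `0` or `±2` (table check). -/
theorem sdot3_slotInt_cubeInt : ∀ i : Fin 12, ∀ c : Fin 8,
    sdot3 (slotInt i) (cubeInt c) = 0 ∨ sdot3 (slotInt i) (cubeInt c) = 2 ∨ sdot3 (slotInt i) (cubeInt c) = -2 := by decide

/-! ### §2 Menu normals in the table -/

/-- **A unit menu normal is a cube diagonal of the grain:** `cubicCoords (A⁻¹ n) = cubeInt c / √3` for some `c : Fin 8`. -/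
theorem exists_cubeInt_of_menu_normal (A : EuclideanSpace ℝ (Fin 3) ≃ₗᵢ[ℝ] EuclideanSpace ℝ (Fin 3))
    {n : EuclideanSpace ℝ (Fin 3)} (hn : ‖n‖ = 1)
    (hmenu : ∀ w ∈ fccSlots, ⟪A w, n⟫_ℝ = 0 ∨ ⟪A w, n⟫_ℝ = Real.sqrt (2 / 3) ∨ ⟪A w, n⟫_ℝ = -Real.sqrt (2 / 3)) :
    ∃ c : Fin 8, cubicCoords (A.symm n) = fun j => (cubeInt c j : ℝ) / Real.sqrt 3 := by
  obtain ⟨k, hk, hkj⟩ := menu_cubic_coords_pm_one A hn hmenu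
  have hs3 : Real.sqrt 3 ≠ 0 := by positivity
  have hcoord : cubicCoords (A.symm n) = fun j => (k j : ℝ) / Real.sqrt 3 := by
    ext j
    rw [← inner_cubicFrame, ← hkj j, ← LinearIsometryEquiv.inner_map_map A (A.symm n) (cubicFrame j),
      LinearIsometryEquiv.apply_symm_apply, real_inner_comm]
    field_simp
  -- `k ∈ {±1}³` is a cube vertex
  have hkfun : ∃ c : Fin 8, cubeInt c = k := by
    have e : k = ![k 0, k 1, k 2] := by ext j; fin_cases j <;> rfl
    rcases hk 0 with h0 | h0 <;> rcases hk 1 with h1 | h1 <;> rcases hk 2 with h2 | h2 <;>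
      · rw [e, h0, h1, h2]
        first
        | exact ⟨0, by decide⟩ | exact ⟨1, by decide⟩ | exact ⟨2, by decide⟩ | exact ⟨3, by decide⟩
        | exact ⟨4, by decide⟩ | exact ⟨5, by decide⟩ | exact ⟨6, by decide⟩ | exact ⟨7, by decide⟩
  obtain ⟨c, hc⟩ := hkfun
  exact ⟨c, by rw [hcoord, ← hc]⟩

/-- **Slot against menu normal, in the table:** `⟪A (slotSite i), n⟫ = (slotInt i ⬝ cubeInt c) / (√2·√3)`. -/
theorem inner_slot_menu_normal (A : EuclideanSpace ℝ (Fin 3) ≃ₗᵢ[ℝ] EuclideanSpace ℝ (Fin 3))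
    {n : EuclideanSpace ℝ (Fin 3)} {c : Fin 8} (hc : cubicCoords (A.symm n) = fun j => (cubeInt c j : ℝ) / Real.sqrt 3)
    (i : Fin 12) : ⟪A (slotSite i), n⟫_ℝ = (sdot3 (slotInt i) (cubeInt c) : ℝ) / (Real.sqrt 2 * Real.sqrt 3) := by
  rw [← LinearIsometryEquiv.apply_symm_apply A n, LinearIsometryEquiv.inner_map_map, inner_eq_cubicCoords,
    cubicCoords_slotSite, hc]
  simp only [dotProduct, Fin.sum_univ_three, slotVec, sdot3, Int.cast_add, Int.cast_mul]
  have hs2 : Real.sqrt 2 ≠ 0 := by positivity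
  have hs3 : Real.sqrt 3 ≠ 0 := by positivity
  field_simp

/-- **The twin image of a negative slot, in the table:** if `slotInt i ⬝ cubeInt c = −2` then
`A (slotSite i) − 2⟪A (slotSite i), n⟫ n = A (pointVec (3 • slotInt i + 4 • cubeInt c))`. -/
theorem twinRefl_slot_eq_pointVec (A : EuclideanSpace ℝ (Fin 3) ≃ₗᵢ[ℝ] EuclideanSpace ℝ (Fin 3))
    {n : EuclideanSpace ℝ (Fin 3)} {c : Fin 8} (hc : cubicCoords (A.symm n) = fun j => (cubeInt c j : ℝ) / Real.sqrt 3)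
    {i : Fin 12} (hd : sdot3 (slotInt i) (cubeInt c) = -2) :
    A (slotSite i) - (2 * ⟪A (slotSite i), n⟫_ℝ) • n = A (pointVec (3 • slotInt i + 4 • cubeInt c)) := by
  have hin := inner_slot_menu_normal A hc i
  rw [hd] at hin
  have hvec : A (slotSite i) - (2 * ⟪A (slotSite i), n⟫_ℝ) • n = A (slotSite i - (2 * ⟪A (slotSite i), n⟫_ℝ) • A.symm n) := by
    rw [map_sub, LinearIsometryEquiv.map_smul, LinearIsometryEquiv.apply_symm_apply]
  rw [hvec]
  congr 1
  apply cubicCoords_injective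
  rw [cubicCoords_sub, cubicCoords_smul, cubicCoords_slotSite, hc, cubicCoords_pointVec, hin]
  ext k
  simp only [Pi.sub_apply, Pi.smul_apply, smul_eq_mul, slotVec, Pi.add_apply]
  simp only [nsmul_eq_mul]
  push_cast
  have hs2 : Real.sqrt 2 ≠ 0 := by positivity
  have hs3 : Real.sqrt 3 ≠ 0 := by positivity
  have h3 : Real.sqrt 3 ^ 2 = 3 := Real.sq_sqrt (by norm_num)
  field_simp
  rw [h3]; ring

/-! ### §3 The abstract dozens are the table dozens -/

/-- **The slot dozen is `dozenQ3 none`.** -/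
theorem slotDozen_eq_image_dozenQ3 (A : EuclideanSpace ℝ (Fin 3) ≃ₗᵢ[ℝ] EuclideanSpace ℝ (Fin 3)) :
    A '' (↑fccSlots : Set (EuclideanSpace ℝ (Fin 3))) =
      (fun q => A (pointVec q)) '' (↑(dozenQ3 none) : Set (Fin 3 → ℤ)) := by
  ext v
  constructor
  · rintro ⟨w, hw, rfl⟩
    obtain ⟨i, rfl⟩ := exists_slotSite_eq (Finset.mem_coe.1 hw)
    refine ⟨3 • slotInt i, Finset.mem_coe.2 (Finset.mem_image.2 ⟨i, Finset.mem_univ _, rfl⟩), ?_⟩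
    simp only [slotSite_eq_pointVec]
  · rintro ⟨q, hq, rfl⟩
    obtain ⟨i, -, rfl⟩ := Finset.mem_image.1 (Finset.mem_coe.1 hq)
    exact ⟨slotSite i, Finset.mem_coe.2 (slotSite_mem i), by simp only [slotSite_eq_pointVec]⟩

/-- **A twin dozen is `dozenQ3 (some c)`.**  For a unit menu normal `n` of `A` there is a cube vertex `c` with
`{A w : ⟪A w, n⟫ ≤ 0} ∪ {A w − 2⟪A w, n⟫ n : ⟪A w, n⟫ < 0} = A·pointVec (dozenQ3 (some c))`. -/
theorem twinDozen_eq_image_dozenQ3 (A : EuclideanSpace ℝ (Fin 3) ≃ₗᵢ[ℝ] EuclideanSpace ℝ (Fin 3))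
    {n : EuclideanSpace ℝ (Fin 3)} (hn : ‖n‖ = 1)
    (hmenu : ∀ w ∈ fccSlots, ⟪A w, n⟫_ℝ = 0 ∨ ⟪A w, n⟫_ℝ = Real.sqrt (2 / 3) ∨ ⟪A w, n⟫_ℝ = -Real.sqrt (2 / 3)) :
    ∃ c : Fin 8,
      (fun w => A w) '' {w | w ∈ fccSlots ∧ ⟪A w, n⟫_ℝ ≤ 0} ∪
          (fun w => A w - (2 * ⟪A w, n⟫_ℝ) • n) '' {w | w ∈ fccSlots ∧ ⟪A w, n⟫_ℝ < 0} =
        (fun q => A (pointVec q)) '' (↑(dozenQ3 (some c)) : Set (Fin 3 → ℤ)) := by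
  obtain ⟨c, hc⟩ := exists_cubeInt_of_menu_normal A hn hmenu
  refine ⟨c, ?_⟩
  have hpos : (0 : ℝ) < Real.sqrt 2 * Real.sqrt 3 := by positivity
  -- sign dictionary between `⟪A (slotSite i), n⟫` and `sdot3 (slotInt i) (cubeInt c)`
  have sgn_le : ∀ i : Fin 12, ⟪A (slotSite i), n⟫_ℝ ≤ 0 ↔ sdot3 (slotInt i) (cubeInt c) ≤ 0 := by
    intro i
    rw [inner_slot_menu_normal A hc i, div_nonpos_iff]
    constructor
    · rintro (⟨_, h⟩ | ⟨h, _⟩)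
      · exact absurd h (not_le.2 hpos)
      · exact_mod_cast h
    · intro h; exact Or.inr ⟨by exact_mod_cast h, hpos.le⟩
  have sgn_lt : ∀ i : Fin 12, ⟪A (slotSite i), n⟫_ℝ < 0 ↔ sdot3 (slotInt i) (cubeInt c) < 0 := by
    intro i
    rw [inner_slot_menu_normal A hc i, div_neg_iff]
    constructor
    · rintro (⟨_, h⟩ | ⟨h, _⟩)
      · exact absurd h (not_lt.2 hpos.le)
      · exact_mod_cast h
    · intro h; exact Or.inr ⟨by exact_mod_cast h, hpos⟩
  ext v
  simp only [Set.mem_union, Set.mem_image, Set.mem_setOf_eq, Finset.mem_coe, dozenQ3, Finset.mem_union, Finset.mem_image,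
    Finset.mem_filter, Finset.mem_univ, true_and]
  constructor
  · rintro (⟨w, ⟨hw, hle⟩, rfl⟩ | ⟨w, ⟨hw, hlt⟩, rfl⟩)
    · obtain ⟨i, rfl⟩ := exists_slotSite_eq hw
      exact ⟨3 • slotInt i, Or.inl ⟨i, (sgn_le i).1 hle, rfl⟩, by rw [slotSite_eq_pointVec]⟩
    · obtain ⟨i, rfl⟩ := exists_slotSite_eq hw
      have hlt' := (sgn_lt i).1 hlt
      have hd : sdot3 (slotInt i) (cubeInt c) = -2 := by
        rcases sdot3_slotInt_cubeInt i c with h | h | h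
        · omega
        · omega
        · exact h
      exact ⟨3 • slotInt i + 4 • cubeInt c, Or.inr ⟨i, hlt', rfl⟩, (twinRefl_slot_eq_pointVec A hc hd).symm⟩
  · rintro ⟨q, (⟨i, hle, rfl⟩ | ⟨i, hlt, rfl⟩), rfl⟩
    · exact Or.inl ⟨slotSite i, ⟨slotSite_mem i, (sgn_le i).2 hle⟩, by rw [slotSite_eq_pointVec]⟩
    · have hd : sdot3 (slotInt i) (cubeInt c) = -2 := by
        rcases sdot3_slotInt_cubeInt i c with h | h | h
        · omega
        · omega
        · exact h
      exact Or.inr ⟨slotSite i, ⟨slotSite_mem i, (sgn_lt i).2 hlt⟩, twinRefl_slot_eq_pointVec A hc hd⟩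

/-- The two cases together: every exact dozen of `menu_or_payer_of_near_endBall` is a table dozen. -/
theorem exists_dozenQ3_of_exactDozen (A : EuclideanSpace ℝ (Fin 3) ≃ₗᵢ[ℝ] EuclideanSpace ℝ (Fin 3))
    {D : Set (EuclideanSpace ℝ (Fin 3))}
    (hD : D = A '' (↑fccSlots : Set (EuclideanSpace ℝ (Fin 3))) ∨
      ∃ n : EuclideanSpace ℝ (Fin 3), ‖n‖ = 1 ∧
        (∀ w ∈ fccSlots, ⟪A w, n⟫_ℝ = 0 ∨ ⟪A w, n⟫_ℝ = Real.sqrt (2 / 3) ∨ ⟪A w, n⟫_ℝ = -Real.sqrt (2 / 3)) ∧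
        D = (fun w => A w) '' {w | w ∈ fccSlots ∧ ⟪A w, n⟫_ℝ ≤ 0} ∪
          (fun w => A w - (2 * ⟪A w, n⟫_ℝ) • n) '' {w | w ∈ fccSlots ∧ ⟪A w, n⟫_ℝ < 0}) :
    ∃ o : Option (Fin 8), D = (fun q => A (pointVec q)) '' (↑(dozenQ3 o) : Set (Fin 3 → ℤ)) := by
  rcases hD with rfl | ⟨n, hn, hmenu, rfl⟩
  · exact ⟨none, slotDozen_eq_image_dozenQ3 A⟩
  · obtain ⟨c, hc⟩ := twinDozen_eq_image_dozenQ3 A hn hmenu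
    exact ⟨some c, hc⟩

/-! ### §4 The universe lemma in table form -/

/-- **THE END-BALL UNIVERSE LEMMA, TABLE FORM.**  GAP(`δ`) ∧ CLASSIFICATION(`δ`), `δ ≥ 5/2`; `X` `1`-separated; `A` a grain
frame; `z ∈ X` with certified slot contacts `z + A (slotSite i)`, `i ∈ S`, and at most `|S| + 1` contacts.  Then every `x ∈ X`,
`x ≠ z`, `dist x z ≤ √3` EITHER has a payer `y ∈ X`, `y ≠ z`, `dist x y ≤ 2`, with at most eleven contacts, OR for some table
dozen `dozenQ3 o` and `q′ ∈ dozenQ3 o`: the docking ball `s = z − A·pointVec q′` lies in `X`, is twelve-touched, its contacts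
are exactly the twelve balls `s + A·pointVec q`, `q ∈ dozenQ3 o` (all in `X`), `dist x s ≤ 1`, and `x = s` or `x = s + A·pointVec q`
for some `q ∈ dozenQ3 o`. -/
theorem menuTable_or_payer_of_near_endBall {δ : ℝ} (hg : KissingGap δ) (hc : KissingClassification δ) (hδ : 5 / 2 ≤ δ)
    (hX : ∀ p ∈ X, ∀ q ∈ X, p ≠ q → 1 ≤ dist p q)
    (A : EuclideanSpace ℝ (Fin 3) ≃ₗᵢ[ℝ] EuclideanSpace ℝ (Fin 3)) {z : EuclideanSpace ℝ (Fin 3)} (hz : z ∈ X)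
    (S : Finset (Fin 12)) (hSX : ∀ i ∈ S, z + A (slotSite i) ∈ X)
    (hdeg : (X.filter fun q => dist z q = 1).card ≤ S.card + 1)
    {x : EuclideanSpace ℝ (Fin 3)} (hx : x ∈ X) (hxz : x ≠ z) (h3 : dist x z ≤ Real.sqrt 3) :
    (∃ y ∈ X, y ≠ z ∧ dist x y ≤ 2 ∧ (X.filter fun q => dist y q = 1).card ≤ 11) ∨
    ∃ o : Option (Fin 8), ∃ q' ∈ dozenQ3 o,
      z - A (pointVec q') ∈ X ∧ (X.filter fun q => dist (z - A (pointVec q')) q = 1).card = 12 ∧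
      (∀ q ∈ dozenQ3 o, z - A (pointVec q') + A (pointVec q) ∈ X) ∧
      (∀ y ∈ X, dist (z - A (pointVec q')) y = 1 → ∃ q ∈ dozenQ3 o, y = z - A (pointVec q') + A (pointVec q)) ∧
      dist x (z - A (pointVec q')) ≤ 1 ∧
      (x = z - A (pointVec q') ∨ ∃ q ∈ dozenQ3 o, x = z - A (pointVec q') + A (pointVec q)) := by
  classical
  -- certified slots as a `Finset` of vectors
  set T : Finset (EuclideanSpace ℝ (Fin 3)) := S.image slotSite with hT
  have hTS : ∀ w ∈ T, w ∈ fccSlots := by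
    intro w hw
    obtain ⟨i, -, rfl⟩ := Finset.mem_image.1 hw
    exact slotSite_mem i
  have hTX : ∀ w ∈ T, z + A w ∈ X := by
    intro w hw
    obtain ⟨i, hi, rfl⟩ := Finset.mem_image.1 hw
    exact hSX i hi
  have hTcard : T.card = S.card := Finset.card_image_of_injective S slotSite_injective
  have hdegT : (X.filter fun q => dist z q = 1).card ≤ T.card + 1 := by rw [hTcard]; exact hdeg
  rcases menu_or_payer_of_near_endBall hg hc hδ hX A hz T hTS hTX hdegT hx hxz h3 with h | h
  · exact Or.inl h
  right
  obtain ⟨D, v', hD, hv'D, hsX, hs12, hocc, hall, hxs, hxcase⟩ := h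
  obtain ⟨o, rfl⟩ := exists_dozenQ3_of_exactDozen A hD
  obtain ⟨q', hq', rfl⟩ := hv'D
  have hq'm : q' ∈ dozenQ3 o := Finset.mem_coe.1 hq'
  refine ⟨o, q', hq'm, hsX, hs12, fun q hq => hocc _ ⟨q, Finset.mem_coe.2 hq, rfl⟩, fun y hy hyd => ?_, hxs, ?_⟩
  · obtain ⟨q, hq, hqe⟩ := hall y hy hyd
    refine ⟨q, Finset.mem_coe.1 hq, ?_⟩
    simp only at hqe
    rw [hqe, add_sub_cancel]
  · rcases hxcase with h | ⟨v, ⟨q, hq, rfl⟩, h⟩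
    · exact Or.inl h
    · exact Or.inr ⟨q, Finset.mem_coe.1 hq, h⟩

/-- **Payer, or on the menu.**  Under the hypotheses of `menuTable_or_payer_of_near_endBall`: every `x ∈ X`, `x ≠ z`,
`dist x z ≤ √3` has a payer `y ≠ z` within `2` (`deg y ≤ 11`), or `x = z + A (pointVec q)` for some `q ∈ menuQ3` — the finite
table of …EndBallMenuDefs (207 integer triples, 147 of squared length `≤ 54`, i.e. within `√3`). -/
theorem mem_menuQ3_or_payer_of_near_endBall {δ : ℝ} (hg : KissingGap δ) (hc : KissingClassification δ) (hδ : 5 / 2 ≤ δ)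
    (hX : ∀ p ∈ X, ∀ q ∈ X, p ≠ q → 1 ≤ dist p q)
    (A : EuclideanSpace ℝ (Fin 3) ≃ₗᵢ[ℝ] EuclideanSpace ℝ (Fin 3)) {z : EuclideanSpace ℝ (Fin 3)} (hz : z ∈ X)
    (S : Finset (Fin 12)) (hSX : ∀ i ∈ S, z + A (slotSite i) ∈ X)
    (hdeg : (X.filter fun q => dist z q = 1).card ≤ S.card + 1)
    {x : EuclideanSpace ℝ (Fin 3)} (hx : x ∈ X) (hxz : x ≠ z) (h3 : dist x z ≤ Real.sqrt 3) :
    (∃ y ∈ X, y ≠ z ∧ dist x y ≤ 2 ∧ (X.filter fun q => dist y q = 1).card ≤ 11) ∨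
    ∃ q ∈ menuQ3, x = z + A (pointVec q) := by
  rcases menuTable_or_payer_of_near_endBall hg hc hδ hX A hz S hSX hdeg hx hxz h3 with h | ⟨o, q', hq', -, -, -, -, -, hx'⟩
  · exact Or.inl h
  right
  rcases hx' with h | ⟨q, hq, h⟩
  · refine ⟨-q', (mem_menuQ3_iff _).2 ⟨o, q', hq', Or.inl rfl⟩, ?_⟩
    rw [h, pointVec_neg, map_neg, sub_eq_add_neg]
  · refine ⟨q - q', (mem_menuQ3_iff _).2 ⟨o, q', hq', Or.inr ⟨q, hq, rfl⟩⟩, ?_⟩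
    rw [h, pointVec_sub, map_sub]; abel

end Summit.Ventures.Crystal3D.Theorems

end
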